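/-
Copyright: statement-level skeleton of a published paper (lit-balaban cell, Phase-2 proof seat p19, gen 7). No claims beyond
what the kernel checks below.
-/
import Mathlib
import Literature.MathematicalPhysics.QuantumFieldTheory.Balaban1983to89.B3TwoVertexBlocks
import Literature.MathematicalPhysics.QuantumFieldTheory.Balaban1983to89.B3Eq320PositiveSubgraphs
import Literature.MathematicalPhysics.QuantumFieldTheory.Balaban1983to89.B3Sect3Graphs318

/-!
# B3 — T. Bałaban, *(Higgs)₂,₃ quantum fields in a finite volume. III. Renormalization*, CMP **88** (1983) 411–445
[Balaban1983Higgs3] — p. 438 [PDF 28]: the PRIMITIVELY DIVERGENT SCALAR SELF-ENERGY GRAPHS **(3.18)** other than the sunset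
(pictures 1–6: the graphs with vector lines and vertices (1.8)/(1.10)) and their generalized graphs **(3.20)** as WORKED MEMBERS of
the family of generalized graphs of Proposition 2.2 (seat p18 gen 7's `famK`): count data, line dimensions, *"degrees equal to 0"*,
*"every proper subgraph is convergent"*, and *"a generalized expression of degree +α represented by some generalized graph whose
every subgraph has a positive degree"* — hence (1.33) for each of them by `prop21_freeLines`

statement-level skeleton of published theorems with citation tags; proofs where landed; nothing here is a claim about
the Yang–Mills mass gap

PDF held: `paper:balaban1983-higgs-2-3-quantum-fields-finite-volume` (journal page = PDF page + 410); pp. 413, 423–424, 428,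
435, 438 [PDF 3, 13–14, 18, 25, 28] read in the OCR text and on the ×2 renders `…/1983-cmp88-higgs23-III-p003-x2.png`,
`…-p028-x2.png` (the pictures (3.18), the displays (1.8), (1.10), (3.19), (3.20)).

CITATION HEADER (lean-in-tree rule).  Part of the lit-balaban TYPED SKELETON (HOME `run/shared/lean/pub/lit-balaban/`), PHASE 2,
seat p19 generation 7 (file 2 of 3; file 1 `B3TwoVertexBlocks` = the closed-form block/degree calculus it instantiates, file 3
`B3Eq318MembersPart2` = the pictures 4–6 in the same format); the
target is seat p18 gen 8's hand-off item *"famK members for the OTHER six pictures of (3.18) … needs their p19 `Counts`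
encodings"* (p18's `B3Eq320SunsetMember` treats the seventh picture).  WHAT IS REPRODUCED: rows **B3.Eq3.18-3.20** (located
members: the pictures (3.18) and their generalized graphs (3.20)) and **B3.Prop2.2** (further worked members of the family) of
`HOME/lit-balaban-r15/ROWS-B3.md` (fold owner r15, referee ref-4).  CONSUMES BY NAME, nothing re-proved: this seat's `Counts`
calculus and `B3TwoVertexBlocks` (`properPos_of_twoVertex`, `degZero_of_twoVertex`, `wholePos_of_twoVertex`,
`properPos_of_oneVertex`, `degZero_of_oneVertex`, `linesConnect_twoVertex`/`_oneVertex`), seat p18's `B3FreeLine` family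
(`ParamsK`, `CGraphK`, `DatumK`, `expansionK`, `famK`, `degQK`, `Is24K`, `prop21_freeLines`), p18 gen 8's constants
`B3Eq322Member.paramsK322` (`d = 3`, `L = 2`, `δ₁ = 1`, menu `{0, ½}`) and (3.20) mechanism
`B3Eq320PositiveSubgraphs.posSubgraphsExcept24_of_degZero` / `posSubgraphs_of_properPos` / `posSubgraphsExcept24_of_properPos`,
p18 gen 3's READING of the pictures `B3Sect3Graphs318` (legend: straight = φ′, wavy = A′, circle = vertex (1.8)/(1.10), dot = (1.6),
arrowhead at a vertex = its differentiation `D^η_B̃`; the fifth picture as printed, GAPS G-B3-06) with its catalogue degrees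
`g318a_deg … g318f_deg`, and r15's (3.19) `B3Sect3Subtraction319.subtracted319`/`eq319`.

THE PRINTED TEXT (verbatim, p. 438).  *"Let us consider the other cases of self-energy graphs for scalar fields. All the remaining
divergent graphs of this type have degrees equal to 0. Primitively divergent graphs, i.e. the graphs [(3.18), seven pictures] are
treated in a simpler way. If Σ(x,x′) is an expression corresponding to any such graph, then we have a graph with mass renormalization
counterterm of the form −Σ_{x′}η^dΣ(x,x′), and we write [(3.19)]. We get a generalized expression of degree +α represented by some
generalized graph whose every subgraph has a positive degree also. Graphically we write it as follows [(3.20)]."*  p. 435: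
*"primitively divergent graphs (graphs whose every proper subgraph is convergent)"*.  p. 428 (Prop. 2.2): *"graphs with arbitrary
numbers of legs and powers of η in vertices, lines with the same exponential factors but with arbitrary dimensions instead of
−d+2"*.

WHAT IS PROVED, and how.  THE COUNT DATA (this seat's `Counts`, `d = 3`, `L = 2`, `δ₁ = 1`; vertices `x = 0`, `x′ = 1`; the
η-power of a vertex = its `VertexKind.etaCount − d`: (1.8)_{n,0} ↦ `n − 1`, (1.10)_{n,0} ↦ `n − 2`, (1.6) ↦ `0`; a differentiation
of a (1.8) vertex acting on the internal φ′-line is a `diffOn`; scalar AND vector lines have dimension `−(d−2)/2` per leg, p. 422;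
no averaged legs): `graph318a` (two (1.10)_{2,0}: φ′-line + both A′-lines `x → x′`), `graph318b` (ONE vertex (1.10)_{4,0} with two
A′-tadpoles), `graph318c` ((1.8)_{2,0}–(1.10)_{2,0}: the φ′-line carries the differentiation of `x`) IN THIS FILE, and IN
`B3Eq318MembersPart2` (same format) `graph318d` (two (1.8)_{2,0}: the φ′-line carries both differentiations), `graph318f` ((1.8)_{3,0}
with an A′-tadpole at `x`, A′-line, φ′-line carrying both differentiations, to (1.8)_{1,0}), and the fifth picture AS PRINTED
`graph318e` ((1.8)_{3,0} whose differentiation is on its EXTERNAL leg; p18 g3: *"not in the catalogue otherwise; NOT divergent"*).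
For each: the line dimensions (`lineDimQ_graph318x`:
`−1` per plain line, `−2`/`−3` for the φ′-line with one/two differentiations), **the whole degree `W = d + e_x + e_{x′} + Σ_l a_l =
0`** (`wholeDeg_graph318x`; `= 1` for `e`) **agreeing with p18 g3's catalogue degree `6 − 2d` (`7 − 2d`) at `d = 3`**
(`wholeDeg_graph318x_eq_deg`: the two degree counts of the tree coincide), and by file 1's criterion (every `a_l < 0`; at the
looped vertex of `f`, `e`: `e_x + a_{tadpole} = 2 − 1 = 1 > 0`) **primitive divergence along EVERY ordering**
(`properPos_graph318x`) and `degZero_graph318x`.  THE GENERALIZED GRAPHS (3.20): `κ318`/`κ318b` put `+α = ½` (*"e.g. α₀ = ½"*,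
p. 421) on the line `0` (a line joining `x` to `x′`; for `b` a tadpole, see below) — members `memberK318x` of `famK` at the
constants `paramsK322`, and **`posSubgraphsExcept24_memberK318x`** (r15's PRINTED hypothesis of Propositions 2.1/2.2 through
positivity, all orderings, instance of `posSubgraphsExcept24_of_degZero`), `posSubgraphs_memberK318x` (every subgraph positive),
`not_is24_memberK318x` (no exceptional (2.4)-block: generic `not_is24K_of_properPos`), **`ineq133_memberK318x`** ((1.33) by
`prop21_freeLines`).  The fifth picture as printed is a CONVERGENT graph: `memberK318e` with `κ ≡ 0` meets the hypothesis outright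
(`posSubgraphsExcept24_memberK318e`, instance of `posSubgraphsExcept24_of_properPos`, whole degree `1 > 0`).  §0: for the ONE-vertex
picture `b` both scalar legs of (1.10) sit at the same point `b₋` (p. 413), so `Σ(x,x′)` is DIAGONAL and the subtraction (3.19) is
EXACT — the tree's `B3Sect3WickCancellation.subtracted319_eq_zero_of_local` (r15's `subtracted319` vanishes for a kernel vanishing off the diagonal, via `eq319`): the counterterm
cancels the graph as in the Wick-ordering remark after (3.7); the count-level member `memberK318b` (degree `+α` on a tadpole,
`η^α ≤ (L^jη)^α`) is recorded for uniformity only.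
HONEST SCOPE: members of the ABSTRACT-amplitude family `famK` (as p18's `memberK322`/`memberK320`: amplitudes = any `IBPAmpK` datum
within the class budgets; the `+α` line is the weighted kernel `K(x,x′)|x−x′|^α`, the `−α` leg the Hölder quotient inside the vertex
function); `d = 3` only (the paper's d = 2 case has other degrees); the pictures are p18 g3's READINGS (`B3Sect3Graphs318` docstrings,
G-B3-06 for the fifth); which x–x′ line carries `+α` is immaterial for the degrees (any connecting line; p. 438 *"a chain of
propagators connecting … x with … x′"*).  D-0026: definitions with bodies (six count data, two exponent vectors, six members) +
theorems; no named facts, no `sorry`; standard axioms.  Unit `lit-balaban-p19-g7` (literature-prover-lit-balaban-p19-g7-0), HOME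
`run/shared/lean/pub/lit-balaban/`, 2026-08-21.
-/

open Finset

namespace Literature.MathematicalPhysics.QuantumFieldTheory.Balaban1983to89.B3Eq318Members

/-! ## §0 The second picture: both scalar legs of (1.10) sit at one point, so (3.19) cancels it exactly

No declaration here: the exact cancellation «graph − counterterm = 0» for a kernel `Σ(x,x′)` vanishing off the diagonal is ALREADY in
the tree as `B3Sect3WickCancellation.subtracted319_eq_zero_of_local` (with the tadpole instance `tadpole_cancellation`), proved from
r15's `eq319`; the one-vertex picture `b` below is exactly that situation (both scalar legs of (1.10)_{4,0} at `b₋`, p. 413), so its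
printed expression is cancelled identically and the count-level member `memberK318b` is recorded for uniformity only. -/

open B3Ineq215 B3Ineq213 B3Sect2FirstEstimate B3Prop1 B3FreeLine B3Eq322Member B3Eq320PositiveSubgraphs B3TwoVertexBlocks

/-! ## §1 Generic: members with positive proper blocks have no exceptional (2.4)-block -/

/-- A block containing a line is represented by a vertex of the quotient graph. [cite: Balaban1983Higgs3, (2.16) p.428] -/
theorem mem_reps_of_mem_before {V : Type} [Fintype V] [DecidableEq V] {m : ℕ} (G : Counts V m) {i : ℕ} {b : V} {l : Fin m}
    (hl : l ∈ G.toModel.before i b) : b ∈ G.toModel.reps i := by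
  rw [G.toModel.mem_before] at hl
  rw [G.toModel.mem_reps, ← hl.2, G.toModel.rep_idem]

/-- If along every ordering every proper non-trivial block has positive degree and the graph has at least two lines, then NO
block is a (2.4)-block of the generalized graph (a (2.4)-block is a single line of degree `0`; with `m ≥ 2` a single line is a
proper block). [cite: Balaban1983Higgs3, (2.4) p.424] -/
theorem not_is24K_of_properPos {n m : ℕ} (G : Counts (Fin n) m) (κ : Fin m → ℚ) (hm : 2 ≤ m)
    (hprop : ∀ (σ : Equiv.Perm (Fin m)) (i : ℕ) (b : Fin n), b ∈ (relabelCounts G σ).toModel.reps i →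
      (relabelCounts G σ).toModel.Nontriv i b → (relabelCounts G σ).toModel.before i b ≠ univ →
      0 < degQ (relabelCounts G σ) i b)
    (σ : Equiv.Perm (Fin m)) (i : ℕ) (b : Fin n) : ¬ Is24K (relabelCounts G σ) (κ ∘ σ) i b := by
  rintro ⟨⟨hdeg, l, -, -, hbef⟩, -⟩
  have hl : l ∈ (relabelCounts G σ).toModel.before i b := by rw [hbef]; exact mem_singleton_self l
  have hne : (relabelCounts G σ).toModel.before i b ≠ univ := by
    rw [hbef]
    intro h
    have := congrArg Finset.card h
    rw [card_singleton, card_univ, Fintype.card_fin] at this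
    omega
  have := hprop σ i b (mem_reps_of_mem_before _ hl) ⟨l, hl⟩ hne
  rw [hdeg] at this
  exact lt_irrefl _ this

/-! ## §2 The extra line dimensions of the generalized graphs (3.20) -/

/-- **The extra line dimensions of the generalized graphs (3.20)** of the two-vertex pictures: `+α = ½` on the line `0` (a line
joining `x` to `x′` — the weight `|x′−x|^α` of the right side of (3.19)), the other lines keep their standard dimensions.
[cite: Balaban1983Higgs3, (3.20) p.438] -/
def κ318 : Fin 3 → ℚ := fun l => if l = 0 then 1 / 2 else 0

/-- The same for the two-line (one-vertex) picture. [cite: Balaban1983Higgs3, (3.20) p.438] -/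
def κ318b : Fin 2 → ℚ := fun l => if l = 0 then 1 / 2 else 0

/-- The exponents are taken from the menu `{0, ½}` of `paramsK322`. [cite: Balaban1983Higgs3, Prop. 2.2 p.428] -/
theorem κ318_mem_menu (Cmax CD : ℝ) (l : Fin 3) : κ318 l ∈ (paramsK322 Cmax CD).menu := by
  unfold κ318 paramsK322; split_ifs <;> simp

/-- The exponents are taken from the menu `{0, ½}` of `paramsK322`. [cite: Balaban1983Higgs3, Prop. 2.2 p.428] -/
theorem κ318b_mem_menu (Cmax CD : ℝ) (l : Fin 2) : κ318b l ∈ (paramsK322 Cmax CD).menu := by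
  unfold κ318b paramsK322; split_ifs <;> simp

/-- The exponents are non-negative. [cite: Balaban1983Higgs3, (3.20) p.438] -/
theorem κ318_nonneg (l : Fin 3) : 0 ≤ κ318 l := by unfold κ318; split_ifs <;> norm_num

/-- The exponents are non-negative. [cite: Balaban1983Higgs3, (3.20) p.438] -/
theorem κ318b_nonneg (l : Fin 2) : 0 ≤ κ318b l := by unfold κ318b; split_ifs <;> norm_num

/-- *"a generalized expression of degree +α"*: the extra dimensions add up to `α = ½`. [cite: Balaban1983Higgs3, (3.20) p.438] -/
theorem sum_κ318 : ∑ l, κ318 l = 1 / 2 := by simp [κ318]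

/-- *"a generalized expression of degree +α"*: the extra dimensions add up to `α = ½`. [cite: Balaban1983Higgs3, (3.20) p.438] -/
theorem sum_κ318b : ∑ l, κ318b l = 1 / 2 := by simp [κ318b]

/-- The zero exponents (a graph of the family with its standard line dimensions) are in the menu. [cite: Balaban1983Higgs3, Prop. 2.2 p.428] -/
theorem zero_mem_menu (Cmax CD : ℝ) : (0 : ℚ) ∈ (paramsK322 Cmax CD).menu := by
  unfold paramsK322; simp

/-! ## §3 The first picture: two vertices (1.10)_{2,0}, the φ′-line and both A′-lines joining them -/

/-- **(3.18), first picture** as a count datum: vertices `x = 0`, `x′ = 1` of type (1.10)_{2,0} (η-power `2 − 2 = 0`); line `0` =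
the φ′-line, lines `1, 2` = the two A′-lines, all `x → x′`; no differentiations, no averaged legs. [cite: Balaban1983Higgs3, (3.18) p.438] -/
noncomputable def graph318a : Counts (Fin 2) 3 where
  src := fun _ => 0
  tgt := fun _ => 1
  touches := fun v => ⟨0, by fin_cases v <;> simp⟩
  diffOn := fun _ _ => 0
  vecLegAvg := fun _ _ => 0
  etaPow := fun _ => 0
  d := 3
  L := 2
  δ₁ := 1
  d_pos := by norm_num
  two_le_L := le_rfl
  δ₁_pos := one_pos

/-- Every line joins `x` to `x′`. [cite: Balaban1983Higgs3, (3.18) p.438] -/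
theorem orient_graph318a : ∀ l, graph318a.src l ≠ graph318a.tgt l → graph318a.src l = 0 := fun _ _ => rfl

/-- **(2.14)**: each line has dimension `−(d−2) = −1` (two legs of dimension `−½`). [cite: Balaban1983Higgs3, (2.14) p.427] -/
theorem lineDimQ_graph318a (l : Fin 3) : lineDimQ graph318a l = -1 := by
  unfold lineDimQ legExpQ Counts.legsOn
  simp only [graph318a, Fin.sum_univ_two]
  norm_num

/-- **p. 438 "degrees equal to 0"**: `W = d + e_x + e_{x′} + Σ_l a_l = 3 + 0 + 0 − 3 = 0`. [cite: Balaban1983Higgs3, (3.18) p.438] -/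
theorem wholeDeg_graph318a :
    (graph318a.d : ℚ) + graph318a.etaPow 0 + graph318a.etaPow 1 + ∑ l, lineDimQ graph318a l = 0 := by
  simp only [lineDimQ_graph318a, sum_const, card_univ, Fintype.card_fin]
  simp [graph318a]

/-- The two degree counts of the tree agree: `W` = p18 g3's catalogue degree `6 − 2d` of the first picture at `d = 3`.
[cite: Balaban1983Higgs3, (3.18) p.438] -/
theorem wholeDeg_graph318a_eq_deg (nbar : ℕ) (hn : 2 ≤ nbar) :
    (graph318a.d : ℚ) + graph318a.etaPow 0 + graph318a.etaPow 1 + ∑ l, lineDimQ graph318a l =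
      (B3Sect3Graphs318.g318a nbar hn).deg 3 := by
  rw [wholeDeg_graph318a, B3Sect3Graphs318.g318a_deg]; norm_num

/-- **Primitive divergence**: along every ordering every proper non-trivial block has positive degree (`2` after one line, `1`
after two). [cite: Balaban1983Higgs3, (3.18) p.438] -/
theorem properPos_graph318a (σ : Equiv.Perm (Fin 3)) (i : ℕ) (b : Fin 2) (hb : b ∈ (relabelCounts graph318a σ).toModel.reps i)
    (hn : (relabelCounts graph318a σ).toModel.Nontriv i b) (hne : (relabelCounts graph318a σ).toModel.before i b ≠ univ) :
    0 < degQ (relabelCounts graph318a σ) i b :=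
  properPos_of_twoVertex graph318a orient_graph318a (fun l => by rw [lineDimQ_graph318a]; norm_num) wholeDeg_graph318a.ge
    (by
      rintro v ⟨l, hs, ht⟩
      exact absurd (hs.trans ht.symm) (by simp [graph318a]))
    σ i b hb hn hne

/-- … while the whole graph has degree `0` along every ordering. [cite: Balaban1983Higgs3, (3.18) p.438] -/
theorem degZero_graph318a (σ : Equiv.Perm (Fin 3)) (i : ℕ) (b : Fin 2)
    (hw : (relabelCounts graph318a σ).toModel.before i b = univ) : degQ (relabelCounts graph318a σ) i b = 0 :=
  degZero_of_twoVertex graph318a orient_graph318a wholeDeg_graph318a σ i b hw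

/-- **The generalized graph (3.20) of the first picture is a member of the family of Proposition 2.2** (`famK`; constants
`paramsK322`) at every size bound `mb ≥ 3`. [cite: Balaban1983Higgs3, Prop. 2.2 p.428] -/
noncomputable def memberK318a (Cmax CD : ℝ) {mb : ℕ} (h : 3 ≤ mb) : CGraphK (paramsK322 Cmax CD) mb where
  n := 2
  m := 3
  m_le := h
  G := graph318a
  d_eq := rfl
  L_eq := rfl
  δ₁_eq := rfl
  conn := linesConnect_twoVertex graph318a ⟨0, rfl, rfl⟩
  κ := κ318
  κ_mem := κ318_mem_menu Cmax CD

/-- **(3.20) for the first picture: the PRINTED hypothesis of Propositions 2.1/2.2 holds for its generalized graph, all orderings,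
through positivity** (instance of `posSubgraphsExcept24_of_degZero`). [cite: Balaban1983Higgs3, (3.20) p.438] -/
theorem posSubgraphsExcept24_memberK318a (Cmax CD : ℝ) {mb : ℕ} (h : 3 ≤ mb) (D : DatumK (paramsK322 Cmax CD)) :
    PosSubgraphsExcept24 (expansionK (paramsK322 Cmax CD) mb D) (memberK318a Cmax CD h) :=
  posSubgraphsExcept24_of_degZero D _ κ318_nonneg (by change (0 : ℚ) < ∑ l, κ318 l; rw [sum_κ318]; norm_num)
    (fun σ i b hb hn hne => properPos_graph318a σ i b hb hn hne) (fun σ i b hw => degZero_graph318a σ i b hw)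

/-- *"whose every subgraph has a positive degree"*: every connected subgraph along every ordering has positive generalized degree.
[cite: Balaban1983Higgs3, (3.20) p.438] -/
theorem posSubgraphs_memberK318a (Cmax CD : ℝ) {mb : ℕ} (h : 3 ≤ mb) (D : DatumK (paramsK322 Cmax CD)) :
    ∀ H : (expansionK (paramsK322 Cmax CD) mb D).Sub (memberK318a Cmax CD h),
      0 < (expansionK (paramsK322 Cmax CD) mb D).subDeg (memberK318a Cmax CD h) H :=
  posSubgraphs_of_properPos D _ κ318_nonneg (fun σ i b hb hn hne => properPos_graph318a σ i b hb hn hne)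
    (fun σ i b hw => by
      change 0 < degQ (relabelCounts graph318a σ) i b + ∑ l, κ318 l
      rw [degZero_graph318a σ i b hw, sum_κ318]; norm_num)

/-- No block of the member is an exceptional (2.4)-block. [cite: Balaban1983Higgs3, (2.4) p.424] -/
theorem not_is24_memberK318a (Cmax CD : ℝ) {mb : ℕ} (h : 3 ≤ mb) (D : DatumK (paramsK322 Cmax CD)) :
    ∀ H : (expansionK (paramsK322 Cmax CD) mb D).Sub (memberK318a Cmax CD h),
      ¬ (expansionK (paramsK322 Cmax CD) mb D).Is24 (memberK318a Cmax CD h) H := by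
  rintro ⟨σ, i, b, hb, hn⟩
  exact not_is24K_of_properPos graph318a κ318 (by norm_num) (fun σ i b hb hn hne => properPos_graph318a σ i b hb hn hne) σ i b

/-- **(1.33) for the generalized graph of the first picture**, as asserted by `prop21_freeLines` (the constant `O(1)(n̄)` of the
family at a size bound `m̄(n̄) ≥ 3`). [cite: Balaban1983Higgs3, Prop. 2.2 p.428] -/
theorem ineq133_memberK318a (Cmax CD : ℝ) (mbar : ℕ → ℕ) (nbar : ℕ) (h : 3 ≤ mbar nbar) (α₀ : ℝ) (h0 : 0 < α₀)
    (h1 : α₀ < 1) :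
    ∃ δ₀ C : ℝ, 0 < δ₀ ∧ 0 < C ∧ ∀ D : DatumK (paramsK322 Cmax CD),
      Ineq133At (famK (paramsK322 Cmax CD) mbar nbar D).toExpansion
        ((famK (paramsK322 Cmax CD) mbar nbar D).single (memberK318a Cmax CD h)) α₀ δ₀ C := by
  obtain ⟨δ₀, hδ₀, H⟩ := prop21_freeLines (paramsK322 Cmax CD) mbar
  obtain ⟨C, hC, HC⟩ := H α₀ h0 h1 nbar
  exact ⟨δ₀, C, hδ₀, hC, fun D => HC D _ (posSubgraphsExcept24_memberK318a Cmax CD h D)⟩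

/-! ## §4 The second picture: ONE vertex (1.10)_{4,0} with two A′-tadpoles -/

/-- **(3.18), second picture** as a count datum: one vertex `x = 0` of type (1.10)_{4,0} (η-power `4 − 2 = 2`), two A′-lines
`x → x` (tadpoles). [cite: Balaban1983Higgs3, (3.18) p.438] -/
noncomputable def graph318b : Counts (Fin 1) 2 where
  src := fun _ => 0
  tgt := fun _ => 0
  touches := fun v => ⟨0, by fin_cases v; simp⟩
  diffOn := fun _ _ => 0
  vecLegAvg := fun _ _ => 0
  etaPow := fun _ => 2
  d := 3
  L := 2
  δ₁ := 1
  d_pos := by norm_num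
  two_le_L := le_rfl
  δ₁_pos := one_pos

/-- **(2.14)**: each tadpole has dimension `−(d−2) = −1` (its two legs sit at the one vertex). [cite: Balaban1983Higgs3, (2.14) p.427] -/
theorem lineDimQ_graph318b (l : Fin 2) : lineDimQ graph318b l = -1 := by
  unfold lineDimQ legExpQ Counts.legsOn
  simp only [graph318b, univ_unique, Fin.default_eq_zero, sum_singleton]
  norm_num

/-- **p. 438 "degrees equal to 0"**: `W = e_x + Σ_l a_l = 2 − 2 = 0`. [cite: Balaban1983Higgs3, (3.18) p.438] -/
theorem wholeDeg_graph318b : (graph318b.etaPow 0 : ℚ) + ∑ l, lineDimQ graph318b l = 0 := by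
  simp only [lineDimQ_graph318b, sum_const, card_univ, Fintype.card_fin]
  simp [graph318b]

/-- The two degree counts of the tree agree: `W` = p18 g3's catalogue degree `6 − 2d` of the second picture at `d = 3`.
[cite: Balaban1983Higgs3, (3.18) p.438] -/
theorem wholeDeg_graph318b_eq_deg (nbar : ℕ) (hn : 4 ≤ nbar) :
    (graph318b.etaPow 0 : ℚ) + ∑ l, lineDimQ graph318b l = (B3Sect3Graphs318.g318b nbar hn).deg 3 := by
  rw [wholeDeg_graph318b, B3Sect3Graphs318.g318b_deg]; norm_num

/-- **Primitive divergence**: a block with ONE tadpole has degree `2 − 1 = 1 > 0`, along either ordering.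
[cite: Balaban1983Higgs3, (3.18) p.438] -/
theorem properPos_graph318b (σ : Equiv.Perm (Fin 2)) (i : ℕ) (b : Fin 1) (hb : b ∈ (relabelCounts graph318b σ).toModel.reps i)
    (hn : (relabelCounts graph318b σ).toModel.Nontriv i b) (hne : (relabelCounts graph318b σ).toModel.before i b ≠ univ) :
    0 < degQ (relabelCounts graph318b σ) i b :=
  properPos_of_oneVertex graph318b (fun l => by rw [lineDimQ_graph318b]; norm_num) wholeDeg_graph318b.ge σ i b hb hn hne

/-- … while the whole graph has degree `0`. [cite: Balaban1983Higgs3, (3.18) p.438] -/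
theorem degZero_graph318b (σ : Equiv.Perm (Fin 2)) (i : ℕ) (b : Fin 1)
    (hw : (relabelCounts graph318b σ).toModel.before i b = univ) : degQ (relabelCounts graph318b σ) i b = 0 :=
  degZero_of_oneVertex graph318b wholeDeg_graph318b σ i b hw

/-- The count-level generalized graph of the second picture (degree `+α` carried by a tadpole: `η^α ≤ (L^jη)^α`; RECORDED FOR
UNIFORMITY — the printed expression is cancelled exactly by its counterterm, `B3Sect3WickCancellation.subtracted319_eq_zero_of_local`) as a member of
the family of Proposition 2.2 at every size bound `mb ≥ 2`. [cite: Balaban1983Higgs3, Prop. 2.2 p.428] -/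
noncomputable def memberK318b (Cmax CD : ℝ) {mb : ℕ} (h : 2 ≤ mb) : CGraphK (paramsK322 Cmax CD) mb where
  n := 1
  m := 2
  m_le := h
  G := graph318b
  d_eq := rfl
  L_eq := rfl
  δ₁_eq := rfl
  conn := linesConnect_oneVertex graph318b
  κ := κ318b
  κ_mem := κ318b_mem_menu Cmax CD

/-- The printed hypothesis of Propositions 2.1/2.2 for this member, through positivity. [cite: Balaban1983Higgs3, (3.20) p.438] -/
theorem posSubgraphsExcept24_memberK318b (Cmax CD : ℝ) {mb : ℕ} (h : 2 ≤ mb) (D : DatumK (paramsK322 Cmax CD)) :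
    PosSubgraphsExcept24 (expansionK (paramsK322 Cmax CD) mb D) (memberK318b Cmax CD h) :=
  posSubgraphsExcept24_of_degZero D _ κ318b_nonneg (by change (0 : ℚ) < ∑ l, κ318b l; rw [sum_κ318b]; norm_num)
    (fun σ i b hb hn hne => properPos_graph318b σ i b hb hn hne) (fun σ i b hw => degZero_graph318b σ i b hw)

/-- Every connected subgraph along every ordering has positive generalized degree. [cite: Balaban1983Higgs3, (3.20) p.438] -/
theorem posSubgraphs_memberK318b (Cmax CD : ℝ) {mb : ℕ} (h : 2 ≤ mb) (D : DatumK (paramsK322 Cmax CD)) :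
    ∀ H : (expansionK (paramsK322 Cmax CD) mb D).Sub (memberK318b Cmax CD h),
      0 < (expansionK (paramsK322 Cmax CD) mb D).subDeg (memberK318b Cmax CD h) H :=
  posSubgraphs_of_properPos D _ κ318b_nonneg (fun σ i b hb hn hne => properPos_graph318b σ i b hb hn hne)
    (fun σ i b hw => by
      change 0 < degQ (relabelCounts graph318b σ) i b + ∑ l, κ318b l
      rw [degZero_graph318b σ i b hw, sum_κ318b]; norm_num)

/-- No block of the member is an exceptional (2.4)-block. [cite: Balaban1983Higgs3, (2.4) p.424] -/
theorem not_is24_memberK318b (Cmax CD : ℝ) {mb : ℕ} (h : 2 ≤ mb) (D : DatumK (paramsK322 Cmax CD)) :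
    ∀ H : (expansionK (paramsK322 Cmax CD) mb D).Sub (memberK318b Cmax CD h),
      ¬ (expansionK (paramsK322 Cmax CD) mb D).Is24 (memberK318b Cmax CD h) H := by
  rintro ⟨σ, i, b, hb, hn⟩
  exact not_is24K_of_properPos graph318b κ318b le_rfl (fun σ i b hb hn hne => properPos_graph318b σ i b hb hn hne) σ i b

/-- (1.33) for this member, as asserted by `prop21_freeLines`. [cite: Balaban1983Higgs3, Prop. 2.2 p.428] -/
theorem ineq133_memberK318b (Cmax CD : ℝ) (mbar : ℕ → ℕ) (nbar : ℕ) (h : 2 ≤ mbar nbar) (α₀ : ℝ) (h0 : 0 < α₀)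
    (h1 : α₀ < 1) :
    ∃ δ₀ C : ℝ, 0 < δ₀ ∧ 0 < C ∧ ∀ D : DatumK (paramsK322 Cmax CD),
      Ineq133At (famK (paramsK322 Cmax CD) mbar nbar D).toExpansion
        ((famK (paramsK322 Cmax CD) mbar nbar D).single (memberK318b Cmax CD h)) α₀ δ₀ C := by
  obtain ⟨δ₀, hδ₀, H⟩ := prop21_freeLines (paramsK322 Cmax CD) mbar
  obtain ⟨C, hC, HC⟩ := H α₀ h0 h1 nbar
  exact ⟨δ₀, C, hδ₀, hC, fun D => HC D _ (posSubgraphsExcept24_memberK318b Cmax CD h D)⟩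

/-! ## §5 The third picture: (1.8)_{2,0} and (1.10)_{2,0}, the φ′-line through the differentiated leg -/

/-- **(3.18), third picture** as a count datum: `x = 0` of type (1.8)_{2,0} (η-power `2 − 1 = 1`) whose differentiation acts on the
φ′-line `0` (`x → x′`), `x′ = 1` of type (1.10)_{2,0} (η-power `0`); lines `1, 2` = the A′-lines `x → x′`. [cite: Balaban1983Higgs3, (3.18) p.438] -/
noncomputable def graph318c : Counts (Fin 2) 3 where
  src := fun _ => 0
  tgt := fun _ => 1
  touches := fun v => ⟨0, by fin_cases v <;> simp⟩
  diffOn := fun v l => if v = 0 ∧ l = 0 then 1 else 0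
  vecLegAvg := fun _ _ => 0
  etaPow := fun v => if v = 0 then 1 else 0
  d := 3
  L := 2
  δ₁ := 1
  d_pos := by norm_num
  two_le_L := le_rfl
  δ₁_pos := one_pos

/-- Every line joins `x` to `x′`. [cite: Balaban1983Higgs3, (3.18) p.438] -/
theorem orient_graph318c : ∀ l, graph318c.src l ≠ graph318c.tgt l → graph318c.src l = 0 := fun _ _ => rfl

/-- **(2.14)**: the φ′-line has dimension `−(d−2) − 1 = −2` (one differentiation), the A′-lines `−1`. [cite: Balaban1983Higgs3, (2.14) p.427] -/
theorem lineDimQ_graph318c (l : Fin 3) : lineDimQ graph318c l = if l = 0 then -2 else -1 := by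
  unfold lineDimQ legExpQ Counts.legsOn
  simp only [graph318c, Fin.sum_univ_two]
  fin_cases l <;> simp <;> norm_num

/-- **p. 438 "degrees equal to 0"**: `W = 3 + 1 + 0 − 2 − 1 − 1 = 0`. [cite: Balaban1983Higgs3, (3.18) p.438] -/
theorem wholeDeg_graph318c :
    (graph318c.d : ℚ) + graph318c.etaPow 0 + graph318c.etaPow 1 + ∑ l, lineDimQ graph318c l = 0 := by
  simp only [lineDimQ_graph318c, Fin.sum_univ_three]
  simp [graph318c]
  norm_num

/-- The two degree counts of the tree agree: `W` = p18 g3's catalogue degree `6 − 2d` of the third picture at `d = 3`.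
[cite: Balaban1983Higgs3, (3.18) p.438] -/
theorem wholeDeg_graph318c_eq_deg (nbar : ℕ) (hn : 2 ≤ nbar) :
    (graph318c.d : ℚ) + graph318c.etaPow 0 + graph318c.etaPow 1 + ∑ l, lineDimQ graph318c l =
      (B3Sect3Graphs318.g318c nbar hn).deg 3 := by
  rw [wholeDeg_graph318c, B3Sect3Graphs318.g318c_deg]; norm_num

/-- **Primitive divergence**: along every ordering every proper non-trivial block has positive degree (`4 + a_{σ0} ∈ {2, 3}`
after one line, `4 + a + a′ ∈ {1, 2}` after two). [cite: Balaban1983Higgs3, (3.18) p.438] -/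
theorem properPos_graph318c (σ : Equiv.Perm (Fin 3)) (i : ℕ) (b : Fin 2) (hb : b ∈ (relabelCounts graph318c σ).toModel.reps i)
    (hn : (relabelCounts graph318c σ).toModel.Nontriv i b) (hne : (relabelCounts graph318c σ).toModel.before i b ≠ univ) :
    0 < degQ (relabelCounts graph318c σ) i b :=
  properPos_of_twoVertex graph318c orient_graph318c (fun l => by rw [lineDimQ_graph318c]; split_ifs <;> norm_num)
    wholeDeg_graph318c.ge
    (by
      rintro v ⟨l, hs, ht⟩
      exact absurd (hs.trans ht.symm) (by simp [graph318c]))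
    σ i b hb hn hne

/-- … while the whole graph has degree `0` along every ordering. [cite: Balaban1983Higgs3, (3.18) p.438] -/
theorem degZero_graph318c (σ : Equiv.Perm (Fin 3)) (i : ℕ) (b : Fin 2)
    (hw : (relabelCounts graph318c σ).toModel.before i b = univ) : degQ (relabelCounts graph318c σ) i b = 0 :=
  degZero_of_twoVertex graph318c orient_graph318c wholeDeg_graph318c σ i b hw

/-- **The generalized graph (3.20) of the third picture is a member of the family of Proposition 2.2** at every size bound
`mb ≥ 3`. [cite: Balaban1983Higgs3, Prop. 2.2 p.428] -/
noncomputable def memberK318c (Cmax CD : ℝ) {mb : ℕ} (h : 3 ≤ mb) : CGraphK (paramsK322 Cmax CD) mb where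
  n := 2
  m := 3
  m_le := h
  G := graph318c
  d_eq := rfl
  L_eq := rfl
  δ₁_eq := rfl
  conn := linesConnect_twoVertex graph318c ⟨0, rfl, rfl⟩
  κ := κ318
  κ_mem := κ318_mem_menu Cmax CD

/-- **(3.20) for the third picture: the PRINTED hypothesis of Propositions 2.1/2.2 holds for its generalized graph, all orderings,
through positivity.** [cite: Balaban1983Higgs3, (3.20) p.438] -/
theorem posSubgraphsExcept24_memberK318c (Cmax CD : ℝ) {mb : ℕ} (h : 3 ≤ mb) (D : DatumK (paramsK322 Cmax CD)) :
    PosSubgraphsExcept24 (expansionK (paramsK322 Cmax CD) mb D) (memberK318c Cmax CD h) :=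
  posSubgraphsExcept24_of_degZero D _ κ318_nonneg (by change (0 : ℚ) < ∑ l, κ318 l; rw [sum_κ318]; norm_num)
    (fun σ i b hb hn hne => properPos_graph318c σ i b hb hn hne) (fun σ i b hw => degZero_graph318c σ i b hw)

/-- Every connected subgraph along every ordering has positive generalized degree. [cite: Balaban1983Higgs3, (3.20) p.438] -/
theorem posSubgraphs_memberK318c (Cmax CD : ℝ) {mb : ℕ} (h : 3 ≤ mb) (D : DatumK (paramsK322 Cmax CD)) :
    ∀ H : (expansionK (paramsK322 Cmax CD) mb D).Sub (memberK318c Cmax CD h),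
      0 < (expansionK (paramsK322 Cmax CD) mb D).subDeg (memberK318c Cmax CD h) H :=
  posSubgraphs_of_properPos D _ κ318_nonneg (fun σ i b hb hn hne => properPos_graph318c σ i b hb hn hne)
    (fun σ i b hw => by
      change 0 < degQ (relabelCounts graph318c σ) i b + ∑ l, κ318 l
      rw [degZero_graph318c σ i b hw, sum_κ318]; norm_num)

/-- No block of the member is an exceptional (2.4)-block. [cite: Balaban1983Higgs3, (2.4) p.424] -/
theorem not_is24_memberK318c (Cmax CD : ℝ) {mb : ℕ} (h : 3 ≤ mb) (D : DatumK (paramsK322 Cmax CD)) :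
    ∀ H : (expansionK (paramsK322 Cmax CD) mb D).Sub (memberK318c Cmax CD h),
      ¬ (expansionK (paramsK322 Cmax CD) mb D).Is24 (memberK318c Cmax CD h) H := by
  rintro ⟨σ, i, b, hb, hn⟩
  exact not_is24K_of_properPos graph318c κ318 (by norm_num) (fun σ i b hb hn hne => properPos_graph318c σ i b hb hn hne) σ i b

/-- (1.33) for the generalized graph of the third picture, as asserted by `prop21_freeLines`. [cite: Balaban1983Higgs3, Prop. 2.2 p.428] -/
theorem ineq133_memberK318c (Cmax CD : ℝ) (mbar : ℕ → ℕ) (nbar : ℕ) (h : 3 ≤ mbar nbar) (α₀ : ℝ) (h0 : 0 < α₀)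
    (h1 : α₀ < 1) :
    ∃ δ₀ C : ℝ, 0 < δ₀ ∧ 0 < C ∧ ∀ D : DatumK (paramsK322 Cmax CD),
      Ineq133At (famK (paramsK322 Cmax CD) mbar nbar D).toExpansion
        ((famK (paramsK322 Cmax CD) mbar nbar D).single (memberK318c Cmax CD h)) α₀ δ₀ C := by
  obtain ⟨δ₀, hδ₀, H⟩ := prop21_freeLines (paramsK322 Cmax CD) mbar
  obtain ⟨C, hC, HC⟩ := H α₀ h0 h1 nbar
  exact ⟨δ₀, C, hδ₀, hC, fun D => HC D _ (posSubgraphsExcept24_memberK318c Cmax CD h D)⟩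

end Literature.MathematicalPhysics.QuantumFieldTheory.Balaban1983to89.B3Eq318Members
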